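import Summits.QuantumFields.BalabanUV.Beta.GAN24.TorusJunction
import Summits.QuantumFields.BalabanUV.Beta.GAN24.DirichletExhaustionDeperiodise
import Summits.QuantumFields.BalabanUV.Beta.GAN24.TransverseDictionary
import Literature.MathematicalPhysics.QuantumFieldTheory.Balaban1983to89.B6Cov2156TorusDelK

/-!
# `BalabanUV.Beta.GAN24.MultiplierDictionary` — binder row G-an2-4 / (CONV-C), S6 dictionary (mm channel), leaf P1-L13c (S6mm-3):
# **THE MULTIPLIER DICTIONARY ON `ℤ^{d+1}`** `wΦ^{(L^k)} κ l z = 2·(L^k)^{−(d+5)} · deltaZ L k ((z,κ),(0,l))` — an2's mm block of the packed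
# resolvent IS Bałaban's printed (1.66) effective action (p2's `deltaZ`), every `L ≥ 1`, `k`, `d`; hence at `d = 3` the hypothesis `hdict`
# of `GAN24/TransverseDictionary` with `cΦ = 2/Lc^8`, and **the mm legs of the wall's propagator binders `hK` / `hKall` UNCONDITIONALLY**
# (`j`-uniform decay `c166Z`, rate `θ = Lc⁻²` with `theta166Z`, decay rate `kappaZ 3 / Lc`)

NOT IN PRINT; OUR PROOF.  HONEST FRAMING (cell contract, verbatim): «discharging `BetaPertH` makes Bałaban's UV stability UNCONDITIONAL — a
real constructive-QFT result; it is NOT the continuum limit and NOT the Clay problem.»  HONEST DEPENDENCY (verbatim): «continuum YM on T⁴ ⇐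
BetaPertH ∧ nine spine estimates (0/9 proved); BetaPertH ⇐ (D1) ∧ (D4) ∧ CAP+tail; G-an2-4 gates asym, D1 and NE2/3/4.»  ROOT LABEL of the
swarm (ref2 ruling (A), verbatim): «T = O-an2-2a: `convC_balaban_of_coer` ⇐ `Coer2157Z d L (gamma2153 (d+1) L)`; NOT G-an2-4's K-slot
`ConvCKWall`; 0 wall binders instantiated».  THIS FILE: 0 wall binders instantiated; it proves the `(inr, inr)` = multiplier–multiplier
LEG BLOCK of the two binder SHAPES (ref2 r1 §3 node N2 for the mm legs) and nothing about the `(inl,inl)`, `(inl,inr)`, `(inr,inl)` blocks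
(GAPS C-gan24p2-5 (b)(i): the ff block is NOT a dictionary matter; road P1 L08–L11).  Cites nothing, mints no fact; assembly over LANDED
theorems BY NAME: `GAN24/TorusJunction.tsum_wΦ_pshift_eq_DelK` (leaf-18, the an2↔b05 junction), pv09-g11 `B6Cov2156TorusDelK.re_DelK_apply_eq`
(`Re Δ_k = deltaPol`), p2-g4 `DirichletExhaustionDeperiodise.eq_mul_deltaZ_of_deltaPol_scalar_decay510` (de-periodisation socket; p2 PART 12
`deltaPol_eq_tsum_deltaZ` inside), an2 `KernelSpecInstance.decay_wΦ`, leaf-18 `TransverseDictionary.mm_*_of_dict` (p200894), p2 PART 8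
`deltaZ_abs_le`/`deltaZ_step_abs_le` (t4-ne2-p2 `ratePair_kerFamily2`).  «not in print; our proof».  NOT summit progress.

CONTENTS (0 sorry).  §1 `pshift_const`, `toT_zero`, **`tsum_wΦ_eq_deltaPol`** (the junction in the literal shape of p2-g4's socket:
`Σ_t wΦ^{(N)} κ l (z + M₀•t) = (2·N^{−(d+5)})·deltaPol (M₀)^{d+1} N ((rep (z mod M₀), κ), (rep 0, l))`, every `N ≥ 1`, `M₀ ≥ 1`).
§2 **`wΦ_eq_deltaZ (L) (k) (κ l z) : wΦ (N := L ^ k) κ l z = (2 * (((L:ℝ)^k)^(d+5))⁻¹) * deltaZ L k (z, κ) (0, l)`**.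
§3 `d = 3`: **`hdict_three`** (`smStep 3 Lc j ^ 2 * wΦ (N := Lc^(j+1)) κ l z = (2 * (Lc^8)⁻¹) * deltaZ Lc (j+1) (z, κ) (0, l)` — `s_m² = Lc^{8j}`
against `(Lc^{j+1})^{−8}`: `j`-free EXACTLY because `2(d+1) = d + 5` at `d = 3`), **`mm_uniformDecays`** (`UniformDecays (j ↦ mmPart (KStepUnit Lc j))
(|2/Lc^8|·c166Z 3) (kappaZ 3/Lc)`, every `Lc ≥ 1`), **`mm_decayCauchy`** (`Lc ≥ 2`: `DecayCauchy (…) (|2/Lc^8|·theta166Z 3·Lc⁻²/(1−Lc⁻²)) Lc⁻²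
(kappaZ 3/Lc)`), **`mm_binders`** (∃-packaged).  READING: the mm block of an2's one-shot `KInvStep Lc j` at the wall's units is, entry by
entry, `(2/Lc^8)·Δ_{j+1}` of [Balaban1984PropagatorsI] (1.66) on `ℤ^4` — the «composes exactly, inherits p2's rates BY NAME» of row P1-L13
for the mm channel, with the factor `2/Lc^{D+4}` of gan24-p1's SKELETON-P1 §7(e) now a kernel theorem.
Unit b2b-balaban-gan24-formalise-leaf-18 (gen 5), 2026-08-20.  NOT the K-slot (3 of 4 leg blocks untouched), NOT `BetaPertH`, NOT continuum, NOT Clay.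
-/

open Finset
open scoped BigOperators ComplexConjugate Matrix

namespace Summit.QuantumFields.BalabanUV.Beta.GAN24.MultiplierDictionary

open Literature.MathematicalPhysics.QuantumFieldTheory
open Literature.MathematicalPhysics.QuantumFieldTheory.Balaban1983to89
open Literature.MathematicalPhysics.QuantumFieldTheory.Balaban1983to89.Beta
open AffineAveraging (Site)
open B5Prop11Plancherel (Tor fine)
open BlockEffectiveAction (DelK)
open B6LowerBound2153Torus (toT rep rep_mem_pbox)
open B6Cov2156Torus (deltaPol)
open B6Cov2156TorusDelK (re_DelK_apply_eq idxEquiv_symm_apply)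
open KernelSpecInstance (wΦ decay_wΦ)
open B4Sect5Exhaustion (K)
open Summit.QuantumFields.BalabanUV.Beta.GAN24.TorusAvatar (toTor)
open Summit.QuantumFields.BalabanUV.Beta.GAN24.TorusPeriodise (pshift)
open Summit.QuantumFields.BalabanUV.Beta.GAN24.TorusJunction (tsum_wΦ_pshift_eq_DelK)
open Summit.QuantumFields.BalabanUV.Beta.GAN24.DirichletExhaustionDeltaZ (deltaZ c166Z theta166Z kappaZ kappaZ_pos)
open Summit.QuantumFields.BalabanUV.Beta.GAN24.DirichletExhaustionDeperiodise (eq_mul_deltaZ_of_deltaPol_scalar_decay510)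
open Summit.QuantumFields.BalabanUV.Beta.GAN24.CombesThomas (UniformDecays DecayCauchy smStep KStepUnit)
open Summit.QuantumFields.BalabanUV.Beta.GAN24.TransverseDictionary (mmPart mm_uniformDecays_of_dict mm_decayCauchy_of_dict
  mm_binders_of_dict)

noncomputable section

variable {d : ℕ}

/-! ## §1 The junction in the torus-representative shape of p2's de-periodisation socket -/

/-- Scalar periods: `pshift (fun _ => M₀) t = M₀ • t`. -/
theorem pshift_const (M₀ : ℕ) (t : Site (d + 1)) : pshift (fun _ : Fin (d + 1) => M₀) t = M₀ • t := by
  funext ν; simp [pshift]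

/-- `toT M 0 = 0`. -/
theorem toT_zero (M : Fin (d + 1) → ℕ) : toT M (0 : Fin (d + 1) → ℤ) = 0 := by
  funext i; simp [toT]

/-- **THE JUNCTION IN SOCKET SHAPE**: for every blocking `N ≥ 1`, every scalar torus `M₀ ≥ 1` and all `κ l z`,
`Σ_t wΦ^{(N)} κ l (z + M₀•t) = (2·N^{−(d+5)}) · deltaPol (M₀)^{d+1} N ((rep (z mod M₀), κ), (rep 0, l))` — `GAN24/TorusJunction.tsum_wΦ_pshift_eq_DelK`
read through pv09-g11's `re_DelK_apply_eq` (`Re Δ_k = deltaPol`, the (1.66) matrix of the torus). -/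
theorem tsum_wΦ_eq_deltaPol (N : ℕ) [NeZero N] (hN : 1 ≤ N) (κ l : Fin (d + 1)) (M₀ : ℕ) [NeZero M₀] (z : Site (d + 1)) :
    ∑' t : Site (d + 1), wΦ (N := N) κ l (z + M₀ • t)
      = (2 * ((N : ℝ) ^ (d + 5))⁻¹) * deltaPol (fun _ : Fin (d + 1) => M₀) N
          (⟨rep (fun _ : Fin (d + 1) => M₀) (toT (fun _ : Fin (d + 1) => M₀) z), rep_mem_pbox _ _⟩, κ)
          (⟨rep (fun _ : Fin (d + 1) => M₀) (toT (fun _ : Fin (d + 1) => M₀) 0), rep_mem_pbox _ _⟩, l) := by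
  have h := tsum_wΦ_pshift_eq_DelK N hN (fun _ : Fin (d + 1) => M₀) 1 one_pos κ l z
  simp only [pshift_const] at h
  rw [h, re_DelK_apply_eq, idxEquiv_symm_apply, idxEquiv_symm_apply, toT_zero]
  rfl

/-! ## §2 THE S6-mm DICTIONARY on `ℤ^{d+1}`: `wΦ^{(L^k)} = 2·L^{−k(d+5)}·Δ_k` ((1.65) of an2's typed system = (1.66) = p2's `deltaZ`) -/

/-- **THE MULTIPLIER DICTIONARY** (every `L ≥ 1`, `k`, `d`, all legs and sites): an2's multiplier-response kernel `wΦ` of the packed resolvent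
of blocking `N = L^k` IS `2·N^{−(d+5)}` times Bałaban's printed (1.66) effective action kernel on `ℤ^{d+1}` (p2's `deltaZ L k`):
`wΦ (N := L^k) κ l z = 2·((L^k)^{d+5})⁻¹ · deltaZ L k (z, κ) (0, l)`.  Proof: `tsum_wΦ_eq_deltaPol` on every scalar torus + p2-g4's
de-periodisation socket `eq_mul_deltaZ_of_deltaPol_scalar_decay510` (exponential decay of `wΦ` at fixed `N`: an2's `decay_wΦ`). -/
theorem wΦ_eq_deltaZ (L : ℕ) [NeZero L] (k : ℕ) (κ l : Fin (d + 1)) (z : Site (d + 1)) :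
    wΦ (N := L ^ k) κ l z = (2 * ((((L : ℕ) : ℝ) ^ k) ^ (d + 5))⁻¹) * deltaZ L k (z, κ) (0, l) := by
  obtain ⟨δ, C, hδ, hdec⟩ := decay_wΦ (N := L ^ k) (d := d)
  have hN : 1 ≤ L ^ k := Nat.one_le_pow _ _ (Nat.pos_of_ne_zero (NeZero.ne L))
  refine eq_mul_deltaZ_of_deltaPol_scalar_decay510 hδ (hdec κ l) L k κ l _ 1 (fun M₀ _ _ z' => ?_) z
  have h := tsum_wΦ_eq_deltaPol (L ^ k) hN κ l M₀ z'
  push_cast at h ⊢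
  exact h

/-! ## §3 `d = 3`: the hypothesis `hdict` of `GAN24/TransverseDictionary` DISCHARGED, `cΦ = 2/Lc^8`, and the mm legs of the K-slot binders -/

/-- **`hdict` AT `d = 3`**: `s_m(j)² · wΦ^{(Lc^{j+1})} κ l z = (2/Lc^8) · deltaZ Lc (j+1) ((z,κ),(0,l))` — the units `s_m(j) = Lc^{4j}` of the wall
(`CombesThomas.smStep 3 Lc j`) against `N^{−(d+5)} = Lc^{−8(j+1)}`: `j`-FREE exactly in four dimensions. -/
theorem hdict_three (Lc : ℕ) [NeZero Lc] (j : ℕ) (κ l : Fin (3 + 1)) (z : Site (3 + 1)) :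
    smStep 3 Lc j ^ 2 * wΦ (N := Lc ^ (j + 1)) κ l z = (2 * ((Lc : ℝ) ^ 8)⁻¹) * deltaZ Lc (j + 1) (z, κ) (0, l) := by
  rw [wΦ_eq_deltaZ Lc (j + 1) κ l z, smStep]
  have hL : (Lc : ℝ) ≠ 0 := Nat.cast_ne_zero.2 (NeZero.ne Lc)
  have e : ((Lc : ℝ) ^ (j * (3 + 1))) ^ 2 * (2 * ((((Lc : ℕ) : ℝ) ^ (j + 1)) ^ (3 + 5))⁻¹) = 2 * ((Lc : ℝ) ^ 8)⁻¹ := by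
    field_simp
    ring
  rw [← mul_assoc, e]

/-- **THE mm LEGS OF THE WALL'S `hK`, UNCONDITIONAL** (`d = 3`, every `Lc ≥ 1`): the multiplier–multiplier parts of the unit-normalised step
resolvents `D_j · KInvStep Lc j · D_j` decay `j`-UNIFORMLY with Bałaban's (1.66) constants:
`UniformDecays (j ↦ mmPart (KStepUnit Lc j)) (|2/Lc^8|·c166Z 3) (kappaZ 3 / Lc)`. -/
theorem mm_uniformDecays (Lc : ℕ) [NeZero Lc] :
    UniformDecays (fun j => mmPart (KStepUnit (d := 3) Lc j)) (|2 * ((Lc : ℝ) ^ 8)⁻¹| * c166Z 3) (kappaZ 3 / Lc) :=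
  mm_uniformDecays_of_dict (hdict_three Lc)

/-- **THE mm LEGS OF THE WALL'S `hKall`, UNCONDITIONAL** (`d = 3`, `Lc ≥ 2`): Cauchy in the exponentially weighted norm with rate `θ = Lc⁻²`:
`DecayCauchy (j ↦ mmPart (KStepUnit Lc j)) (|2/Lc^8|·theta166Z 3·Lc⁻²/(1 − Lc⁻²)) Lc⁻² (kappaZ 3 / Lc)`. -/
theorem mm_decayCauchy (Lc : ℕ) [NeZero Lc] (hLc : 2 ≤ Lc) :
    DecayCauchy (fun j => mmPart (KStepUnit (d := 3) Lc j))
      (|2 * ((Lc : ℝ) ^ 8)⁻¹| * theta166Z 3 * (((Lc : ℝ) ^ 2)⁻¹) / (1 - ((Lc : ℝ) ^ 2)⁻¹)) (((Lc : ℝ) ^ 2)⁻¹) (kappaZ 3 / Lc) :=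
  mm_decayCauchy_of_dict hLc (hdict_three Lc)

/-- **THE mm CHANNEL OF THE K-SLOT, UNCONDITIONAL** (`d = 3`, `Lc ≥ 2`): `∃ C, δ > 0, cK, 0 ≤ θ < 1` with the wall's two binder SHAPES
`UniformDecays` (hK) and `DecayCauchy` (hKall) for the mm parts of `j ↦ D_j · KInvStep Lc j · D_j` at the adopted units — ref2 r1 §3 N2 for the
`(inr, inr)` block.  NOT the other blocks; NOT `ConvCKWall`; NOT `BetaPertH`, NOT continuum, NOT Clay. -/
theorem mm_binders (Lc : ℕ) [NeZero Lc] (hLc : 2 ≤ Lc) :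
    ∃ C δ cK θ : ℝ, 0 < δ ∧ 0 ≤ θ ∧ θ < 1 ∧
      UniformDecays (fun j => mmPart (KStepUnit (d := 3) Lc j)) C δ ∧
      DecayCauchy (fun j => mmPart (KStepUnit (d := 3) Lc j)) cK θ δ :=
  mm_binders_of_dict hLc (hdict_three Lc)

end

end Summit.QuantumFields.BalabanUV.Beta.GAN24.MultiplierDictionary
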